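import Summits.Schanuel.Schanuel.Theorems.RoySmallValueDirichletGap.Negative.ThueSiegelNonVacuity
import Summits.Schanuel.Schanuel.Theorems.RoySmallValueDirichletGap.Negative.FrequentlyFalseLiouville

/-!
# `RoySmallValueDirichletGap` with "for infinitely many `D`" is FALSE — uniformity in `D` is load-bearing
(negative lemma for crux `stmt-Schanuel-1050`)

Roy 2013 (Mathematika 59 = arXiv:1301.0663), Theorem 1.1, and the crux
`Summit.Schanuel.Schanuel.Theses.RoyCriterion.RoySmallValueDirichletGap` assume the small-value
hypothesis "for each sufficiently large positive integer `D`". We show that the variant with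
`∃ᶠ D in atTop` (infinitely many `D`) in place of `∀ᶠ D in atTop` is FALSE, with parameters
`τ = 3/2`, `β = 2`, `ν = 13/5` strictly INSIDE the open window `(5/2, 8/3]` of the crux
(`roySmallValueDirichletGap_false_with_frequently`); the construction works for EVERY `ν < 4`, so the
`∃ᶠ`-variant of Roy's PRINTED Theorem 1.1 (threshold `8/3` here) is false too
(`roy2013_thm_1_1_false_with_frequently`, `ν = 3`). Witness point: `(0, η∞)` with the fast Liouville
number `η∞ = ∑ₙ 2^{−2^{4ⁿ}}` of `Negative/FrequentlyFalseLiouville.lean` (transcendental). At the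
scales `D = 2e(n)`, `e(n) = 2^{4ⁿ}`: the Thue–Siegel polynomial of `Negative/ThueSiegelNonVacuity.lean`
has EXACT `𝒟₁`-zeros of order `3⌊D^{3/2}⌋` at the rational point `(0, s_n)` (partial sum), height
`≤ e^{D²/2}·2^{e(n)²} ≤ e^{D²}`, and moving to `(0, η∞)` at distance `≤ 2·2^{−e(n)⁴}` costs a factor
`(e(n)+1)² · ‖t'‖ · L^L e^{e(n)} · e(n)` (`norm_aeval_zero_sub_le`), which `2^{−e(n)⁴}` absorbs
(`numerics`): `|𝒟₁ⁱP(0, η∞)| ≤ exp(−D^{ν})`, any `ν < 4` (`frequently_hyp_at_eta`). CONSEQUENCE for provers: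
any proof of the crux must use the hypothesis at (essentially) consecutive degrees `D`, as Roy's
descent (`D* < D`) does; no argument working scale by scale can succeed. Everything is proved; no
definitions, no named facts.
-/

noncomputable section

namespace Summit.Schanuel.Schanuel.Theorems.RoySmallValueDirichletGapFrequently

open Filter Finset MvPolynomial Complex
open Literature.NumberTheory.Transcendental
open Summit.Schanuel.Schanuel.Theorems.RoySmallValueDirichletGapThueSiegel
open Summit.Schanuel.Schanuel.Theorems.RoySmallValueDirichletGapDirichlet (eventually_nat_rpow_le
  eventually_nat_rpow_log_le)

/-! ### Perturbation of the values of `𝒟₁ⁿ` in the second coordinate -/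

/-- `‖y^b − r^b‖ ≤ H ‖y − r‖` on the unit disc, for `b ≤ H`. [folklore] -/
theorem norm_pow_sub_pow_le_of_le {y r : ℂ} (hy : ‖y‖ ≤ 1) (hr : ‖r‖ ≤ 1) {b H : ℕ} (hb : b ≤ H) :
    ‖y ^ b - r ^ b‖ ≤ H * ‖y - r‖ := by
  have key : ∀ b : ℕ, ‖y ^ b - r ^ b‖ ≤ b * ‖y - r‖ := by
    intro b
    induction b with
    | zero => simp
    | succ b ih =>
      have hsplit : y ^ (b + 1) - r ^ (b + 1) = y * (y ^ b - r ^ b) + (y - r) * r ^ b := by ring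
      rw [hsplit]
      calc ‖y * (y ^ b - r ^ b) + (y - r) * r ^ b‖
          ≤ ‖y‖ * ‖y ^ b - r ^ b‖ + ‖y - r‖ * ‖r‖ ^ b := by
            refine (norm_add_le _ _).trans ?_
            rw [norm_mul, norm_mul, norm_pow]
        _ ≤ 1 * (b * ‖y - r‖) + ‖y - r‖ * 1 := by
            gcongr
            exact pow_le_one₀ (norm_nonneg _) hr
        _ = (b + 1 : ℕ) * ‖y - r‖ := by push_cast; ring
  exact (key b).trans (mul_le_mul_of_nonneg_right (by exact_mod_cast hb) (norm_nonneg _))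

/-- **Perturbation bound**: for a box polynomial `Q = ∑ t_{ab}X₁ᵃX₂ᵇ` on `{0..H}²` and `|y|, |r| ≤ 1`,
`|𝒟₁ⁿQ(0, y) − 𝒟₁ⁿQ(0, r)| ≤ (H+1)² ‖t‖ · n! e^H · H |y − r|`. [folklore] -/
theorem norm_aeval_zero_sub_le {H : ℕ} (t : Fin (H + 1) × Fin (H + 1) → ℤ) (n : ℕ) {y r : ℂ}
    (hy : ‖y‖ ≤ 1) (hr : ‖r‖ ≤ 1) :
    ‖aeval ![0, y] (royD^[n] (polyOfCoeffs t)) - aeval ![0, r] (royD^[n] (polyOfCoeffs t))‖ ≤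
      (((H + 1) * (H + 1) : ℕ) : ℝ) * ‖t‖ * (n.factorial * Real.exp H) * (H * ‖y - r‖) := by
  rw [aeval_zero_iterate_royD_polyOfCoeffs, aeval_zero_iterate_royD_polyOfCoeffs, ← Finset.sum_sub_distrib]
  calc ‖∑ ab : Fin (H + 1) × Fin (H + 1), ((t ab : ℂ) * (y ^ (ab.2 : ℕ) * (taylorInt n (monoXY ab.1 ab.2) : ℂ)) -
          (t ab : ℂ) * (r ^ (ab.2 : ℕ) * (taylorInt n (monoXY ab.1 ab.2) : ℂ)))‖
      ≤ ∑ ab : Fin (H + 1) × Fin (H + 1), ‖(t ab : ℂ) * (y ^ (ab.2 : ℕ) * (taylorInt n (monoXY ab.1 ab.2) : ℂ)) -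
          (t ab : ℂ) * (r ^ (ab.2 : ℕ) * (taylorInt n (monoXY ab.1 ab.2) : ℂ))‖ := norm_sum_le _ _
    _ ≤ ∑ _ab : Fin (H + 1) × Fin (H + 1), ‖t‖ * (n.factorial * Real.exp H) * (H * ‖y - r‖) := by
        refine Finset.sum_le_sum fun ab _ => ?_
        have hb : (ab.2 : ℕ) ≤ H := Nat.lt_succ_iff.1 ab.2.isLt
        have hfac : (t ab : ℂ) * (y ^ (ab.2 : ℕ) * (taylorInt n (monoXY ab.1 ab.2) : ℂ)) -
            (t ab : ℂ) * (r ^ (ab.2 : ℕ) * (taylorInt n (monoXY ab.1 ab.2) : ℂ)) =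
            (t ab : ℂ) * (taylorInt n (monoXY ab.1 ab.2) : ℂ) * (y ^ (ab.2 : ℕ) - r ^ (ab.2 : ℕ)) := by ring
        rw [hfac, norm_mul, norm_mul, Complex.norm_intCast, Complex.norm_intCast]
        have h1 : |(t ab : ℝ)| ≤ ‖t‖ := by
          have := norm_le_pi_norm t ab; rwa [Int.norm_eq_abs] at this
        have h2 : |(taylorInt n (monoXY ab.1 ab.2) : ℝ)| ≤ n.factorial * Real.exp H := by
          have h : |(taylorInt n (monoXY ab.1 ab.2) : ℝ)| ≤ n.factorial * Real.exp (ab.2 : ℕ) := by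
            have h' := abs_taylorInt_monoXY_le n ab.1 ab.2
            simpa [Int.cast_abs] using h'
          refine h.trans (mul_le_mul_of_nonneg_left (Real.exp_le_exp.2 (by exact_mod_cast hb)) ?_)
          positivity
        have h3 : ‖y ^ (ab.2 : ℕ) - r ^ (ab.2 : ℕ)‖ ≤ H * ‖y - r‖ :=
          norm_pow_sub_pow_le_of_le hy hr hb
        have h0' : 0 ≤ |(taylorInt n (monoXY ab.1 ab.2) : ℝ)| := abs_nonneg _
        exact mul_le_mul (mul_le_mul h1 h2 h0' (norm_nonneg _)) h3 (norm_nonneg _) (by positivity)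
    _ = (((H + 1) * (H + 1) : ℕ) : ℝ) * ‖t‖ * (n.factorial * Real.exp H) * (H * ‖y - r‖) := by
        rw [Finset.sum_const, Finset.card_univ, nsmul_eq_mul]
        simp [Fintype.card_prod, Fintype.card_fin, mul_assoc]

/-! ### The numerical inequality at the scales `D = 2h`, `h = e(n)` -/

/-- `2^{3/2} ≤ 3` and `2^ν ≤ 16` for `ν ≤ 4`. [folklore] -/
theorem two_rpow_bounds {ν : ℝ} (hν : ν ≤ 4) : (2 : ℝ) ^ ((3 : ℝ) / 2) ≤ 3 ∧ (2 : ℝ) ^ ν ≤ 16 := by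
  constructor
  · have h : ((2 : ℝ) ^ ((3 : ℝ) / 2)) ^ (2 : ℕ) ≤ (3 : ℝ) ^ (2 : ℕ) := by
      rw [← Real.rpow_natCast, ← Real.rpow_mul (by norm_num)]; norm_num
    exact le_of_pow_le_pow_left₀ (by norm_num) (by norm_num) h
  · calc (2 : ℝ) ^ ν ≤ (2 : ℝ) ^ (4 : ℝ) := Real.rpow_le_rpow_of_exponent_le (by norm_num) hν
      _ = 16 := by norm_num

set_option maxHeartbeats 400000 in
/-- **The numerical inequality**: for `ν < 4`, eventually in `h`,
`(h+1)² · (e^{2h²} 2^{h²}) · (L^L e^h) · (h · 2·2^{−h⁴}) ≤ exp(−(2h)^ν)`, `L = 3⌊(2h)^{3/2}⌋`.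
[folklore] -/
theorem numerics {ν : ℝ} (hν : ν < 4) : ∀ᶠ h : ℕ in atTop,
    ((h : ℝ) + 1) ^ 2 * (Real.exp (2 * (h : ℝ) ^ 2) * (2 : ℝ) ^ (h * h)) *
      (((3 * ⌊(2 * (h : ℝ)) ^ ((3 : ℝ) / 2)⌋₊ : ℕ) : ℝ) ^ (3 * ⌊(2 * (h : ℝ)) ^ ((3 : ℝ) / 2)⌋₊) *
        Real.exp h) *
      ((h : ℝ) * (2 * ((2 : ℝ) ^ (h ^ 4))⁻¹)) ≤ Real.exp (-(2 * (h : ℝ)) ^ ν) := by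
  have hc : (0 : ℝ) < Real.log 2 / 16 := by have := Real.log_pos (by norm_num : (1:ℝ) < 2); positivity
  have hev := (((((eventually_nat_rpow_le 6 (show (1 : ℝ) < 4 by norm_num) hc).and
    (eventually_nat_rpow_le (2 + Real.log 2) (show (2 : ℝ) < 4 by norm_num) hc)).and
    (eventually_nat_rpow_le (9 * Real.log 9) (show (3 : ℝ) / 2 < 4 by norm_num) hc)).and
    (eventually_nat_rpow_log_le (show (3 : ℝ) / 2 < 4 by norm_num) (show (0:ℝ) ≤ 27 / 2 by norm_num) hc)).and
    (eventually_nat_rpow_le 16 hν hc)).and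
    (eventually_nat_rpow_le (Real.log 2) (show (0 : ℝ) < 4 by norm_num) hc)
  filter_upwards [hev, eventually_ge_atTop 1] with h hh hh1
  obtain ⟨⟨⟨⟨⟨e1, e2⟩, e3⟩, e4⟩, e5⟩, e6⟩ := hh
  have hx1 : (1 : ℝ) ≤ h := by exact_mod_cast hh1
  have hx0 : (0 : ℝ) < h := by linarith
  set x : ℝ := (h : ℝ) with hx
  -- the count `L`
  set L : ℕ := 3 * ⌊(2 * x) ^ ((3 : ℝ) / 2)⌋₊ with hL
  have h2x : (2 * x) ^ ((3 : ℝ) / 2) = (2 : ℝ) ^ ((3 : ℝ) / 2) * x ^ ((3 : ℝ) / 2) :=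
    Real.mul_rpow (by norm_num) hx0.le
  have hx32 : 1 ≤ x ^ ((3 : ℝ) / 2) := Real.one_le_rpow hx1 (by norm_num)
  have hLx : (L : ℝ) ≤ 9 * x ^ ((3 : ℝ) / 2) := by
    rw [hL]; push_cast
    calc (3 : ℝ) * ⌊(2 * x) ^ ((3 : ℝ) / 2)⌋₊ ≤ 3 * (2 * x) ^ ((3 : ℝ) / 2) :=
          mul_le_mul_of_nonneg_left (Nat.floor_le (by positivity)) (by norm_num)
      _ = 3 * (2 : ℝ) ^ ((3 : ℝ) / 2) * x ^ ((3 : ℝ) / 2) := by rw [h2x]; ring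
      _ ≤ 3 * 3 * x ^ ((3 : ℝ) / 2) := by gcongr; exact (two_rpow_bounds hν.le).1
      _ = 9 * x ^ ((3 : ℝ) / 2) := by ring
  have hL1 : 1 ≤ L := by
    have : 1 ≤ ⌊(2 * x) ^ ((3 : ℝ) / 2)⌋₊ := Nat.le_floor (by
      rw [h2x]; push_cast
      exact one_le_mul_of_one_le_of_one_le (Real.one_le_rpow (by norm_num) (by norm_num)) hx32)
    omega
  have hL0 : (0 : ℝ) < L := by exact_mod_cast hL1
  clear_value x L
  have hlogx : 0 ≤ Real.log x := Real.log_nonneg hx1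
  have hlog9 : 0 ≤ Real.log 9 := Real.log_nonneg (by norm_num)
  have hlog2 : 0 < Real.log 2 := Real.log_pos (by norm_num)
  have hLlogL : (L : ℝ) * Real.log L ≤ 9 * Real.log 9 * x ^ ((3 : ℝ) / 2) +
      27 / 2 * x ^ ((3 : ℝ) / 2) * Real.log x := by
    have hlogL : Real.log L ≤ Real.log 9 + 3 / 2 * Real.log x := by
      calc Real.log L ≤ Real.log (9 * x ^ ((3 : ℝ) / 2)) := Real.log_le_log hL0 hLx
        _ = Real.log 9 + 3 / 2 * Real.log x := by
            rw [Real.log_mul (by norm_num) (by positivity), Real.log_rpow hx0]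
    calc (L : ℝ) * Real.log L ≤ L * (Real.log 9 + 3 / 2 * Real.log x) :=
          mul_le_mul_of_nonneg_left hlogL hL0.le
      _ ≤ 9 * x ^ ((3 : ℝ) / 2) * (Real.log 9 + 3 / 2 * Real.log x) :=
          mul_le_mul_of_nonneg_right hLx (by positivity)
      _ = _ := by ring
  -- rewrite every factor as an exponential
  have hf1 : (x + 1) ^ 2 ≤ Real.exp (2 * x) := by
    have h1 : x + 1 ≤ Real.exp x := by have := Real.add_one_le_exp x; linarith
    calc (x + 1) ^ 2 ≤ (Real.exp x) ^ 2 := pow_le_pow_left₀ (by linarith) h1 2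
      _ = Real.exp (2 * x) := by rw [← Real.exp_nat_mul]; norm_num
  have hf2 : (2 : ℝ) ^ (h * h) = Real.exp (x ^ 2 * Real.log 2) := by
    rw [← Real.rpow_natCast, Real.rpow_def_of_pos (by norm_num), hx]; push_cast; ring_nf
  have hf3 : (L : ℝ) ^ L = Real.exp (L * Real.log L) := by
    rw [← Real.rpow_natCast, Real.rpow_def_of_pos hL0]; ring_nf
  have hf4 : x ≤ Real.exp x := by have := Real.add_one_le_exp x; linarith
  have hf5 : (2 : ℝ) * ((2 : ℝ) ^ (h ^ 4))⁻¹ = Real.exp (Real.log 2 - x ^ 4 * Real.log 2) := by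
    rw [Real.exp_sub, Real.exp_log (by norm_num), ← Real.rpow_natCast, Real.rpow_def_of_pos (by norm_num),
      hx, div_eq_mul_inv]
    push_cast; ring_nf
  -- the exponent bookkeeping
  have hx4 : x ^ (4 : ℝ) = x ^ 4 := by exact_mod_cast Real.rpow_natCast x 4
  have hxr1 : x ^ (1 : ℝ) = x := Real.rpow_one x
  have hxr2 : x ^ (2 : ℝ) = x ^ 2 := Real.rpow_two x
  have hxr0 : x ^ (0 : ℝ) = 1 := Real.rpow_zero x
  rw [hx4] at e1 e2 e3 e4 e5 e6
  rw [hxr1] at e1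
  rw [hxr2] at e2
  rw [hxr0, mul_one] at e6
  have h26 : (2 * x) ^ ν ≤ 16 * x ^ ν := by
    rw [Real.mul_rpow (by norm_num) hx0.le]
    exact mul_le_mul_of_nonneg_right (two_rpow_bounds hν.le).2 (by positivity)
  have hexpo : 2 * x + 2 * x ^ 2 + x ^ 2 * Real.log 2 + L * Real.log L + x + x +
      (Real.log 2 - x ^ 4 * Real.log 2) ≤ -(2 * x) ^ ν := by
    have hsum : 2 * x + 2 * x ^ 2 + x ^ 2 * Real.log 2 + L * Real.log L + x + x + Real.log 2 +
        (2 * x) ^ ν ≤ x ^ 4 * Real.log 2 := by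
      have : 6 * x + (2 + Real.log 2) * x ^ 2 + (9 * Real.log 9 * x ^ ((3 : ℝ) / 2) +
          27 / 2 * x ^ ((3 : ℝ) / 2) * Real.log x) + 16 * x ^ ν + Real.log 2 ≤
          6 * (Real.log 2 / 16 * x ^ 4) := by linarith only [e1, e2, e3, e4, e5, e6]
      have hx4pos : 0 ≤ x ^ 4 * Real.log 2 := by positivity
      linarith only [this, hLlogL, h26, hx4pos, hx0]
    linarith only [hsum]
  -- assemble
  calc (x + 1) ^ 2 * (Real.exp (2 * x ^ 2) * (2 : ℝ) ^ (h * h)) * ((L : ℝ) ^ L * Real.exp x) *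
        (x * (2 * ((2 : ℝ) ^ (h ^ 4))⁻¹))
      ≤ Real.exp (2 * x) * (Real.exp (2 * x ^ 2) * Real.exp (x ^ 2 * Real.log 2)) *
        (Real.exp (L * Real.log L) * Real.exp x) * (Real.exp x * Real.exp (Real.log 2 - x ^ 4 * Real.log 2)) := by
          rw [hf2, hf3, hf5]
          gcongr
    _ = Real.exp (2 * x + 2 * x ^ 2 + x ^ 2 * Real.log 2 + L * Real.log L + x + x +
          (Real.log 2 - x ^ 4 * Real.log 2)) := by simp only [← Real.exp_add]; ring_nf
    _ ≤ Real.exp (-(2 * x) ^ ν) := Real.exp_le_exp.2 hexpo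


/-! ### Assembly: the hypothesis holds for infinitely many `D` at `(0, η∞)` -/

set_option maxHeartbeats 400000 in
/-- **At the transcendental point `(0, η∞)` the small-value hypothesis of the crux holds for
INFINITELY MANY `D`**, with `τ = 3/2`, `β = 2` and ANY `ν < 4` (this covers the whole open
window `(5/2, 8/3]` of the crux AND Roy's proved range above it, so "for each sufficiently large `D`"
is load-bearing already in the printed Theorem 1.1): at the scales `D = 2e(n)`, take the Thue–Siegel polynomial with exact zeros at the
rational point `(0, s_n)` (`s_n` the `n`-th partial sum of `η∞`) and move to `(0, η∞)`, at distance
`≤ 2·2^{−e(n)⁴}`. [folklore] -/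
theorem frequently_hyp_at_eta {ν : ℝ} (hν : ν < 4) :
    ∃ᶠ D : ℕ in atTop, ∃ P : MvPolynomial (Fin 2) ℤ, P ≠ 0 ∧ P.totalDegree ≤ D ∧
      (mvPolyHeight P : ℝ) ≤ Real.exp ((D : ℝ) ^ (2 : ℝ)) ∧
      ∀ i : ℕ, i < 3 * ⌊(D : ℝ) ^ ((3 : ℝ) / 2)⌋₊ →
        ‖aeval ![(0 : ℂ), ((∑' m : ℕ, ((2 : ℝ) ^ 2 ^ 4 ^ m)⁻¹ : ℝ) : ℂ)] (royD^[i] P)‖ ≤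
          Real.exp (-(D : ℝ) ^ ν) := by
  rw [Filter.frequently_atTop]
  intro N
  obtain ⟨D₀, hD₀⟩ := Filter.eventually_atTop.1
    (exists_taylor_kernel (τ := 3 / 2) (β := 2) (by norm_num) (by norm_num) (by norm_num) (by norm_num))
  obtain ⟨h₀, hh₀⟩ := Filter.eventually_atTop.1 (numerics hν)
  -- the index `n`, the scale `h = e(n)`, `D = 2h`
  obtain ⟨n, hn⟩ : ∃ n : ℕ, n = N + D₀ + h₀ := ⟨_, rfl⟩
  obtain ⟨h, hh⟩ : ∃ h : ℕ, h = 2 ^ 4 ^ n := ⟨_, rfl⟩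
  have hnh : n + 2 ≤ h := hh ▸ add_two_le_e n
  have hh1 : 1 ≤ h := by omega
  refine ⟨2 * h, by omega, ?_⟩
  obtain ⟨t, ht0, hker, hnorm⟩ := hD₀ (2 * h) (by omega)
  have hnum := hh₀ h (by omega)
  have hK : 2 * h / 2 = h := by omega
  have hKr : ((2 * h / 2 : ℕ) : ℝ) = (h : ℝ) := by rw [hK]
  have hDr : ((2 * h : ℕ) : ℝ) = 2 * (h : ℝ) := by push_cast; ring
  have hx1 : (1 : ℝ) ≤ h := by exact_mod_cast hh1
  have hx0 : (0 : ℝ) < h := by linarith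
  -- the number and its `n`-th partial sum
  have hηpos := eta_pos
  have hηhalf := eta_le_half
  obtain ⟨htail0, htail⟩ := tail_bounds n
  rw [e_succ, ← hh] at htail
  have ha0 : 0 < ∑ m ∈ range (n + 1), (2 : ℕ) ^ (2 ^ 4 ^ n - 2 ^ 4 ^ m) := numerator_pos n
  obtain ⟨a, ha⟩ : ∃ a : ℕ, a = ∑ m ∈ range (n + 1), (2 : ℕ) ^ (2 ^ 4 ^ n - 2 ^ 4 ^ m) := ⟨_, rfl⟩
  rw [← ha] at ha0
  have hs : ∑ m ∈ range (n + 1), ((2 : ℝ) ^ 2 ^ 4 ^ m)⁻¹ = (a : ℝ) / (2 : ℝ) ^ h := by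
    rw [partialSum_eq n, ← ha, ← hh]
  rw [hs] at htail0 htail
  have ha0z : ((a : ℕ) : ℤ) ≠ 0 := by exact_mod_cast ha0.ne'
  have hq0 : ((2 : ℤ) ^ h) ≠ 0 := by positivity
  have hs_le : (a : ℝ) / (2 : ℝ) ^ h ≤ 1 := by linarith
  have hs_pos : 0 < (a : ℝ) / (2 : ℝ) ^ h := by positivity
  have ha_le : (a : ℝ) ≤ (2 : ℝ) ^ h := by
    rwa [div_le_one (by positivity)] at hs_le
  -- the complex points
  have hy1 : ‖((∑' m : ℕ, ((2 : ℝ) ^ 2 ^ 4 ^ m)⁻¹ : ℝ) : ℂ)‖ ≤ 1 := by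
    rw [Complex.norm_real, Real.norm_eq_abs, abs_of_pos hηpos]; linarith
  have hr1 : ‖(((a : ℝ) / (2 : ℝ) ^ h : ℝ) : ℂ)‖ ≤ 1 := by
    rw [Complex.norm_real, Real.norm_eq_abs, abs_of_pos hs_pos]; exact hs_le
  have hpt : ((((a : ℕ) : ℤ) : ℂ) / ((((2 : ℤ) ^ h : ℤ)) : ℂ)) = (((a : ℝ) / (2 : ℝ) ^ h : ℝ) : ℂ) := by
    push_cast; ring
  have hdist : ‖((∑' m : ℕ, ((2 : ℝ) ^ 2 ^ 4 ^ m)⁻¹ : ℝ) : ℂ) - (((a : ℝ) / (2 : ℝ) ^ h : ℝ) : ℂ)‖ ≤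
      2 * ((2 : ℝ) ^ h ^ 4)⁻¹ := by
    rw [← Complex.ofReal_sub, Complex.norm_real, Real.norm_eq_abs, abs_of_pos htail0]
    exact htail
  -- the polynomial
  refine ⟨polyOfCoeffs fun ab => t ab * ((a : ℕ) : ℤ) ^ (2 * h / 2 - (ab.2 : ℕ)) * ((2 : ℤ) ^ h) ^ (ab.2 : ℕ),
    polyOfCoeffs_ne_zero (rescaled_ne_zero ht0 ha0z hq0), ?_, ?_, ?_⟩
  · exact (totalDegree_polyOfCoeffs_le _).trans (by omega)
  · -- height
    have hR : max |(((a : ℕ) : ℤ) : ℝ)| |((((2 : ℤ) ^ h : ℤ)) : ℝ)| ≤ (2 : ℝ) ^ h := by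
      refine max_le ?_ ?_
      · push_cast; rw [abs_of_nonneg (by positivity)]; exact ha_le
      · push_cast; rw [abs_of_nonneg (by positivity)]
    have ht' := norm_rescaled_le t ((a : ℕ) : ℤ) ((2 : ℤ) ^ h)
    have hRpow : (max |(((a : ℕ) : ℤ) : ℝ)| |((((2 : ℤ) ^ h : ℤ)) : ℝ)|) ^ (2 * h / 2) =
        (max |(((a : ℕ) : ℤ) : ℝ)| |((((2 : ℤ) ^ h : ℤ)) : ℝ)|) ^ h := by rw [hK]
    rw [hRpow] at ht'
    have hnorm' : ‖t‖ ≤ Real.exp (2 * (h : ℝ) ^ 2) := by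
      refine hnorm.trans (le_of_eq ?_)
      rw [hDr, Real.rpow_two]; ring_nf
    have h2hh : ((2 : ℝ) ^ h) ^ h ≤ Real.exp (2 * (h : ℝ) ^ 2) := by
      rw [← pow_mul, ← Real.rpow_natCast, Real.rpow_def_of_pos (by norm_num)]
      refine Real.exp_le_exp.2 ?_
      have hl2 : Real.log 2 ≤ 2 := by have := Real.log_two_lt_d9; linarith
      push_cast
      nlinarith [hl2, sq_nonneg (h : ℝ)]
    calc (mvPolyHeight (polyOfCoeffs fun ab => t ab * ((a : ℕ) : ℤ) ^ (2 * h / 2 - (ab.2 : ℕ)) *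
            ((2 : ℤ) ^ h) ^ (ab.2 : ℕ)) : ℝ)
        ≤ ‖t‖ * (max |(((a : ℕ) : ℤ) : ℝ)| |((((2 : ℤ) ^ h : ℤ)) : ℝ)|) ^ h :=
          (mvPolyHeight_polyOfCoeffs_le _).trans ht'
      _ ≤ Real.exp (2 * (h : ℝ) ^ 2) * ((2 : ℝ) ^ h) ^ h := by gcongr
      _ ≤ Real.exp (2 * (h : ℝ) ^ 2) * Real.exp (2 * (h : ℝ) ^ 2) := by gcongr
      _ = Real.exp (((2 * h : ℕ) : ℝ) ^ (2 : ℝ)) := by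
          rw [← Real.exp_add, hDr, Real.rpow_two]; ring_nf
  · -- values
    intro i hi
    rw [hDr] at hi ⊢
    have hzero : aeval ![(0 : ℂ), ((((a : ℕ) : ℤ) : ℂ) / ((((2 : ℤ) ^ h : ℤ)) : ℂ))]
        (royD^[i] (polyOfCoeffs fun ab => t ab * ((a : ℕ) : ℤ) ^ (2 * h / 2 - (ab.2 : ℕ)) *
          ((2 : ℤ) ^ h) ^ (ab.2 : ℕ))) = 0 := by
      rw [aeval_rescaled t ((a : ℕ) : ℤ) ((2 : ℤ) ^ h) hq0 i, hker i (by rwa [hDr]), Int.cast_zero,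
        mul_zero]
    rw [hpt] at hzero
    have key := norm_aeval_zero_sub_le
      (fun ab => t ab * ((a : ℕ) : ℤ) ^ (2 * h / 2 - (ab.2 : ℕ)) * ((2 : ℤ) ^ h) ^ (ab.2 : ℕ)) i hy1 hr1
    rw [hzero, sub_zero] at key
    refine key.trans ?_
    -- bound the four factors
    have hL1 : 1 ≤ 3 * ⌊(2 * (h : ℝ)) ^ ((3 : ℝ) / 2)⌋₊ := by
      have : 1 ≤ ⌊(2 * (h : ℝ)) ^ ((3 : ℝ) / 2)⌋₊ := Nat.le_floor (by
        have : (1 : ℝ) ≤ (2 * (h : ℝ)) ^ ((3 : ℝ) / 2) := Real.one_le_rpow (by linarith) (by norm_num)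
        simpa using this)
      omega
    have hfac : (i.factorial : ℝ) ≤
        ((3 * ⌊(2 * (h : ℝ)) ^ ((3 : ℝ) / 2)⌋₊ : ℕ) : ℝ) ^ (3 * ⌊(2 * (h : ℝ)) ^ ((3 : ℝ) / 2)⌋₊) := by
      have h1 : i.factorial ≤ i ^ i := Nat.factorial_le_pow i
      have h2 : i ^ i ≤ (3 * ⌊(2 * (h : ℝ)) ^ ((3 : ℝ) / 2)⌋₊) ^ i := Nat.pow_le_pow_left hi.le i
      have h3 : (3 * ⌊(2 * (h : ℝ)) ^ ((3 : ℝ) / 2)⌋₊) ^ i ≤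
          (3 * ⌊(2 * (h : ℝ)) ^ ((3 : ℝ) / 2)⌋₊) ^ (3 * ⌊(2 * (h : ℝ)) ^ ((3 : ℝ) / 2)⌋₊) :=
        Nat.pow_le_pow_right hL1 hi.le
      exact_mod_cast h1.trans (h2.trans h3)
    have ht' := norm_rescaled_le t ((a : ℕ) : ℤ) ((2 : ℤ) ^ h)
    have hRpow : (max |(((a : ℕ) : ℤ) : ℝ)| |((((2 : ℤ) ^ h : ℤ)) : ℝ)|) ^ (2 * h / 2) =
        (max |(((a : ℕ) : ℤ) : ℝ)| |((((2 : ℤ) ^ h : ℤ)) : ℝ)|) ^ h := by rw [hK]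
    rw [hRpow] at ht'
    have hR : max |(((a : ℕ) : ℤ) : ℝ)| |((((2 : ℤ) ^ h : ℤ)) : ℝ)| ≤ (2 : ℝ) ^ h := by
      refine max_le ?_ ?_
      · push_cast; rw [abs_of_nonneg (by positivity)]; exact ha_le
      · push_cast; rw [abs_of_nonneg (by positivity)]
    have hnorm' : ‖t‖ ≤ Real.exp (2 * (h : ℝ) ^ 2) := by
      refine hnorm.trans (le_of_eq ?_)
      rw [hDr, Real.rpow_two]; ring_nf
    have htt : ‖(fun ab : Fin (2 * h / 2 + 1) × Fin (2 * h / 2 + 1) =>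
        t ab * ((a : ℕ) : ℤ) ^ (2 * h / 2 - (ab.2 : ℕ)) * ((2 : ℤ) ^ h) ^ (ab.2 : ℕ))‖ ≤
        Real.exp (2 * (h : ℝ) ^ 2) * (2 : ℝ) ^ (h * h) := by
      refine ht'.trans ?_
      rw [pow_mul]
      gcongr
    have hcard : ((((2 * h / 2 + 1) * (2 * h / 2 + 1)) : ℕ) : ℝ) = ((h : ℝ) + 1) ^ 2 := by
      rw [hK]; push_cast; ring
    calc ((((2 * h / 2 + 1) * (2 * h / 2 + 1)) : ℕ) : ℝ) *
          ‖(fun ab : Fin (2 * h / 2 + 1) × Fin (2 * h / 2 + 1) =>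
            t ab * ((a : ℕ) : ℤ) ^ (2 * h / 2 - (ab.2 : ℕ)) * ((2 : ℤ) ^ h) ^ (ab.2 : ℕ))‖ *
          ((i.factorial : ℝ) * Real.exp ((2 * h / 2 : ℕ) : ℝ)) *
          (((2 * h / 2 : ℕ) : ℝ) * ‖((∑' m : ℕ, ((2 : ℝ) ^ 2 ^ 4 ^ m)⁻¹ : ℝ) : ℂ) -
            (((a : ℝ) / (2 : ℝ) ^ h : ℝ) : ℂ)‖)
        ≤ ((h : ℝ) + 1) ^ 2 * (Real.exp (2 * (h : ℝ) ^ 2) * (2 : ℝ) ^ (h * h)) *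
          (((3 * ⌊(2 * (h : ℝ)) ^ ((3 : ℝ) / 2)⌋₊ : ℕ) : ℝ) ^ (3 * ⌊(2 * (h : ℝ)) ^ ((3 : ℝ) / 2)⌋₊) *
            Real.exp h) *
          ((h : ℝ) * (2 * ((2 : ℝ) ^ (h ^ 4))⁻¹)) := by
          rw [hcard, hKr]
          gcongr
      _ ≤ Real.exp (-(2 * (h : ℝ)) ^ ν) := hnum

/-- **UNIFORMITY IN `D` IS LOAD-BEARING**: the variant of `RoySmallValueDirichletGap` in which the
small-value hypothesis is only required for INFINITELY MANY `D` (`∃ᶠ D` in place of "for each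
sufficiently large `D`") is FALSE — at the transcendental point `(0, η∞)`, `η∞ = ∑ₙ 2^{-2^{4ⁿ}}`,
with `τ = 3/2`, `β = 2`, `ν = 13/5` (inside the gap `(5/2, 8/3]`). So any proof of the crux must use
the hypothesis at (essentially) consecutive scales, as Roy's descent does.
[cite: Roy2013, Theorem 1.1 ("for each sufficiently large positive integer D")] -/
theorem roySmallValueDirichletGap_false_with_frequently :
    ¬ (∀ (ξ η : ℂ), η ≠ 0 → ∀ (β τ ν : ℝ), 1 ≤ τ → τ < 2 → τ < β → 2 + β - τ < ν →
      (∃ᶠ D : ℕ in Filter.atTop, ∃ P : MvPolynomial (Fin 2) ℤ, P ≠ 0 ∧ P.totalDegree ≤ D ∧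
        (mvPolyHeight P : ℝ) ≤ Real.exp ((D : ℝ) ^ β) ∧
        ∀ i : ℕ, i < 3 * ⌊(D : ℝ) ^ τ⌋₊ →
          ‖MvPolynomial.aeval ![ξ, η] (royD^[i] P)‖ ≤ Real.exp (-(D : ℝ) ^ ν)) →
      IsAlgebraic ℚ ξ ∧ IsAlgebraic ℚ η) := fun hC =>
  transcendental_eta (hC 0 _ (Complex.ofReal_ne_zero.2 eta_pos.ne') 2 (3 / 2) (13 / 5) (by norm_num)
    (by norm_num) (by norm_num) (by norm_num) (frequently_hyp_at_eta (by norm_num))).2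

/-- **Even Roy's PRINTED Theorem 1.1 needs "for each sufficiently large `D`"**: its `∃ᶠ D`-variant
(with the printed, stronger lower bound on `ν`) is false as well — same witness, `ν = 3 > 8/3`.
[cite: Roy2013, Theorem 1.1] -/
theorem roy2013_thm_1_1_false_with_frequently :
    ¬ (∀ (ξ η : ℂ), η ≠ 0 → ∀ (β τ ν : ℝ), 1 ≤ τ → τ < 2 → τ < β →
      2 + β - τ + (τ - 1) * (2 - τ) / (β + 1 - τ) < ν →
      (∃ᶠ D : ℕ in Filter.atTop, ∃ P : MvPolynomial (Fin 2) ℤ, P ≠ 0 ∧ P.totalDegree ≤ D ∧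
        (mvPolyHeight P : ℝ) ≤ Real.exp ((D : ℝ) ^ β) ∧
        ∀ i : ℕ, i < 3 * ⌊(D : ℝ) ^ τ⌋₊ →
          ‖MvPolynomial.aeval ![ξ, η] (royD^[i] P)‖ ≤ Real.exp (-(D : ℝ) ^ ν)) →
      IsAlgebraic ℚ ξ ∧ IsAlgebraic ℚ η) := fun hC =>
  transcendental_eta (hC 0 _ (Complex.ofReal_ne_zero.2 eta_pos.ne') 2 (3 / 2) 3 (by norm_num)
    (by norm_num) (by norm_num) (by norm_num) (frequently_hyp_at_eta (by norm_num))).2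


end Summit.Schanuel.Schanuel.Theorems.RoySmallValueDirichletGapFrequently

end
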